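import Literature.MathematicalPhysics.QuantumFieldTheory.Balaban1983to89.Node00.CarriersB10
import Literature.MathematicalPhysics.QuantumFieldTheory.Balaban1983to89.B9PinCarriersKLevelV1

/-!
# NODE 00 (YM-PLAN Track A) — STAGE 3′(Y) OF THE CARRIERS OF RECORD: the [Balaban1985BackgroundPropagators] bundle `Y` PINNED to def-Y's
# `carriersY` over the record's own k-level geometry (Stage 3: `d₆, ℓ₆, b₀, b₁`) with values in the record's `SU(N) ⊂ M_N(ℂ)`, the OPERATOR LAYER
# carried as an explicit residual datum; the pin as an UP-SIDE modification; the cumulative record predicate `IsRecordOfRecord₉CB10Y → ₉CB10 → ₉C`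

NODE 00 CARRIER MODULE, second pin (seat `pub-ymgap-node00-def` g29, 2026-08-26; design note `HOME/pub-ymgap-node00-def/STAGE10-CARRIERS-DESIGN-g29.md`;
director-ym LINE №32 rails (ii)(v): def-Y = dag-n06-a types the GEOMETRY ∕ INDEX layer Literature-side with the pinning datum a PARAMETER, «the ₉ ∕ 3′ knit remains
the successor's» — this file is that knit).  APPEND-ONLY: a NEW importing module; `CarriersB10`, `Record9`, def-Y's MODULES 1–5 untouched and CONSUMED BY NAME
(`B9PinCarriersKLevelV1.OperatorLayerY`, `carriersY`, `b9LeafX_carriersY`, `carriersY_nonempty_I9`; `B9PinMembersKLevelV1.MemberY`).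

WHAT IS PINNED HERE.  In `Residual₅.Y P : PrintedCarriers9X` EVERYTHING was free data; at a record of this module `Y P` IS `carriersY θ.d₆ θ.ℓ₆ … Mstar M_N(ℂ) SU(N) ops`
(the same bundle at every run `P` — [B9]'s family index `MemberY` ranges over all tori and levels): index, constants (`d + 1`, `c₃₅ = 10`), geometry `geo9Y`,
backgrounds `bg9Y`, Cor. 3.6's cube predicate, (3.154)'s `dOmega`, the Sect.-E data `OmK ∕ inΛ ∕ unitDist` are OBJECTS OF RECORD (def-Y MODULES 2–5 over NODE 00's
Stage-3 tower geometry `KIdx θ.d₆ θ.ℓ₆ …`); the coefficient algebra is `M_N(ℂ)` with the operator norm ([Balaban1985BackgroundPropagators] p.390; Mathlib's scoped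
`Matrix.Norms.L2Operator` structure, the cell's convention of `Node00.B7GaugeGroup` ∕ `Record8`) and the gauge group the record's `SU(N)` (`B7Prop2SpecialUnitary.specialUnitaryUnits`,
def-Y's word l.11078 «`𝔸 := M_N ℂ`, `G := SU(N)`»).  WHAT STAYS RESIDUAL, EXPLICITLY: the OPERATOR LAYER `ops : OpsY N θ Mstar` — Bałaban's propagators `G′(U), G(U), (Q′G′²Q′*)⁻¹,
G_D, G₁, H, H₁, 𝔊`, the random-walk expansions (3.90)∕(3.98)∕(3.107), the Sect.-E kernel `C^{(k)}(Λ)`, (3.49)'s `P`, (3.132)'s kernels and their analyticity ∕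
positivity predicates (def-Y's `OperatorLayerY`, 23 fields; the unassigned XL layer) — and the floor `Mstar`.  CONSEQUENCE, SAID (R433): at a record of this
module the `b9` leaf IS `B9LeafX (Y9OfRecord N θ₃ Mstar ops)` (`leaf_b9_iff_of_isRecordOfRecord₉CB10Y`) whose GEOMETRIC hypotheses are discharged by def-Y's knit
(`b9LeafX_carriersY`: what remains displayed is exactly the operator layer's obligations + the [B6] block = N03 at the record), but the leaf is STILL
CLOSABLE BY A JUNK OPERATOR LAYER (zero kernels meet every printed bound — def-Y's kernel witness `B9PinCarriersNonVacuity.exists_ops_b9LeafX`, staged 2026-08-26,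
pub-ymgap INBOX l.11134 (K2)) until that layer is an object of record — so N06 is NOT bookable over this predicate in ∀-form; the value of the pin is «geometry ∕ index ∕ backgrounds of [B9] discharged by name at the record», one stage, as ₇'s `rep`.

THE PIN IS UP-SIDE and CUMULATIVE: `Stage5Params.pinY θ Y₀` replaces `res.Y` only (datum unchanged, `datumOfRecord₅_pinY`; the `b10` leaf of the [B10] pin unchanged,
`upOfRecord₅C_pinY_b10`); the record predicate applies it ON TOP of the [B10] pin (`((θ.toStage5).pinB10).pinY …`), refines `IsRecordOfRecord₉CB10` (hence `₉C`, `₅C`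
at the shadow) WITH THE SAME DATUM AND WORLD, and is inhabited exactly when `IsRecordOfRecord₉C` is (the pin adds data, no proviso, no admissibility clause).
HONEST FRAMING: definitions + kernel bookkeeping; NO estimate; no operator of [B9] defined; N06 NOT discharged; counts unmoved; one finite T⁴ programme at fixed ε
— NOT continuum ∕ ℝ⁴ ∕ infinite volume ∕ OS ∕ mass gap ∕ Clay.  No `sorry`, no `axiom`, no `opaque`, no `instance`, no `notation`. -/

noncomputable section

open MeasureTheory

namespace Literature.MathematicalPhysics.QuantumFieldTheory.Balaban1983to89.Node00

open T4Continuum AveragingRT T4FiniteEpsInhabited FlowStep FlowStepRuns DagBinding T4DatumAssembly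
open B9PinCarriersKLevelV1 (OperatorLayerY carriersY)
open B9PinMembersKLevelV1 (MemberY)
open B7Prop2SpecialUnitary (specialUnitaryUnits)
open scoped Matrix.Norms.L2Operator

/-! ## §1. The [B9] bundle of record as a function of the Stage-3 dictionary, the floor `M⋆` and the operator layer -/

section Bundle

variable (N : ℕ)

/-- **The operator layer of the [B9] group at the Stage-3 dictionary `θ`** with floor `Mstar`: def-Y's `OperatorLayerY` at EVERY member of the [B9] family index over
the record's k-level geometry (`d₆, ℓ₆, b₀, b₁`), coefficient algebra `M_N(ℂ)` (operator norm), gauge group `SU(N)`.  A TYPE OF RESIDUAL DATA (Bałaban's propagators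
and their companions — not defined in the tree). [cite: Balaban1985BackgroundPropagators, Thms 3.1–3.15 pp.397–432 (the operators the statements are about)] -/
abbrev OpsY (θ : Stage3Params) (Mstar : ℕ) : Type 1 :=
  ∀ x : MemberY θ.d₆ θ.ℓ₆ θ.hd' θ.hL' θ.b₀ θ.b₁ Mstar,
    OperatorLayerY θ.d₆ θ.ℓ₆ θ.hd' θ.hL' θ.b₀ θ.b₁ Mstar (Matrix (Fin N) (Fin N) ℂ) (specialUnitaryUnits (Fin N)) x

/-- **THE [B9] CARRIER BUNDLE OF RECORD** at `(θ, Mstar, ops)`: def-Y's `carriersY` over the record's Stage-3 geometry, `M_N(ℂ)`, `SU(N)`, and the operator layer `ops`.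
[cite: Balaban1985BackgroundPropagators, Thm 3.1 p.397 + p.399 (the family), Thms 3.1–3.15 pp.397–432 (the carriers of the typed statements)] -/
def Y9OfRecord (θ : Stage3Params) (Mstar : ℕ) (ops : OpsY N θ Mstar) : PrintedCarriers9X :=
  carriersY θ.d₆ θ.ℓ₆ θ.hd' θ.hL' θ.b₀ θ.b₁ Mstar (Matrix (Fin N) (Fin N) ℂ) (specialUnitaryUnits (Fin N)) ops

/-- The bundle's index is def-Y's member type over the record's geometry (`rfl`). [cite: Balaban1985BackgroundPropagators, p.399 (bookkeeping)] -/
theorem Y9OfRecord_I9 (θ : Stage3Params) (Mstar : ℕ) (ops : OpsY N θ Mstar) :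
    (Y9OfRecord N θ Mstar ops).I9 = MemberY θ.d₆ θ.ℓ₆ θ.hd' θ.hL' θ.b₀ θ.b₁ Mstar := rfl

/-- The bundle's index is inhabited whenever `L ≥ 5` (def-Y's guard; the band `0 < b₀ ≤ b₁` is the record's `Stage3Params.hb`). [cite: Balaban1985BackgroundPropagators, p.399 (the family is inhabited)] -/
theorem Y9OfRecord_nonempty_I9 (θ : Stage3Params) (Mstar : ℕ) (ops : OpsY N θ Mstar) (hℓ : 4 ≤ θ.ℓ₆) : Nonempty (Y9OfRecord N θ Mstar ops).I9 :=
  B9PinCarriersKLevelV1.carriersY_nonempty_I9 _ hℓ θ.hb.1 θ.hb.2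

end Bundle

/-! ## §2. The pin on Stage-5 parameters (UP-SIDE) -/

section Pin

variable (F : T4Family) (N : ℕ) [NeZero N]

/-- **The Y pin of a Stage-5 residual**: the run-indexed [B9] bundle := `Y₀` at every run; every other field unchanged. [cite: Balaban1985BackgroundPropagators, Thms 3.1–3.15 pp.397–432 (the objects the leaf `b9` reads)] -/
def Residual₅.pinY (r : Residual₅ F N) (Y₀ : PrintedCarriers9X) : Residual₅ F N :=
  { r with Y := fun _ => Y₀ }

/-- **The Y pin of Stage-5 parameters**. [cite: Balaban1985BackgroundPropagators, Thm 3.1 p.397 (objects of record, Stage 3′(Y))] -/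
def Stage5Params.pinY (θ : Stage5Params F N) (Y₀ : PrintedCarriers9X) : Stage5Params F N :=
  { θ with res := θ.res.pinY F N Y₀ }

/-- The pin touches neither the Stage-3 dictionary, nor `γ`, nor admissibility (`rfl` ∕ `Iff.rfl`). [cite: Balaban1984PropagatorsII, pp.223–250 (bookkeeping)] -/
theorem Stage5Params.pinY_toStage3Params (θ : Stage5Params F N) (Y₀ : PrintedCarriers9X) : (θ.pinY F N Y₀).toStage3Params = θ.toStage3Params := rfl

/-- … (admissibility). [cite: Balaban1983RegularityDecay, (1.6) p.572 (hypothesis dictionary; bookkeeping)] -/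
theorem Stage5Params.pinY_admissible_iff (θ : Stage5Params F N) (Y₀ : PrintedCarriers9X) : (θ.pinY F N Y₀).Admissible ↔ θ.Admissible := Iff.rfl

/-- … nor the density tower (induction on `k`). [cite: Balaban1988Convergent, (0.2) p.244 (bookkeeping)] -/
theorem densOfRecord₅_pinY (θ : Stage5Params F N) (Y₀ : PrintedCarriers9X) (p : B12.RunParams) :
    ∀ k, densOfRecord₅ F N (θ.pinY F N Y₀) p k = densOfRecord₅ F N θ p k
  | 0 => rfl
  | k + 1 => by
    show θ.res.R p k (TrhoOfRecord F N p.K k (densOfRecord₅ F N (θ.pinY F N Y₀) p k)) =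
      θ.res.R p k (TrhoOfRecord F N p.K k (densOfRecord₅ F N θ p k))
    rw [densOfRecord₅_pinY θ Y₀ p k]

/-- … nor the machine. [cite: Balaban1988Convergent, (0.2) p.244 (bookkeeping)] -/
theorem machineOfRecord₅_pinY (θ : Stage5Params F N) (Y₀ : PrintedCarriers9X) : machineOfRecord₅ F N (θ.pinY F N Y₀) = machineOfRecord₅ F N θ := by
  unfold machineOfRecord₅
  simp only [densOfRecord₅_pinY]
  rfl

/-- … nor the assembled datum: THE PIN IS UP-SIDE. [cite: Balaban1988Convergent, (0.2) p.244 (bookkeeping)] -/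
theorem datumOfRecord₅_pinY (θ : Stage5Params F N) (Y₀ : PrintedCarriers9X) : datumOfRecord₅ F N (θ.pinY F N Y₀) = datumOfRecord₅ F N θ := by
  unfold datumOfRecord₅
  rw [machineOfRecord₅_pinY]

/-- **The `b9` leaf of the C-binding at Y-pinned parameters IS `B9LeafX Y₀`** (`Iff.rfl`: the N-binding's `b9 := B9LeafX Y`). [cite: Balaban1985BackgroundPropagators, Thms 3.1–3.15 pp.397–432 (the leaf `B9LeafX`)] -/
theorem upOfRecord₅C_pinY_b9_iff (θ : Stage5Params F N) (Y₀ : PrintedCarriers9X) (P : B12.RunParams) :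
    (upOfRecord₅C F N (θ.pinY F N Y₀) P).b9 ↔ B9LeafX Y₀ := Iff.rfl

/-- The `b10` leaf is unchanged by the Y pin (`rfl`) — so the [B10] pin's face survives the cumulative pin. [cite: Balaban1985UV3, Thm 1 p.257 (bookkeeping)] -/
theorem upOfRecord₅C_pinY_b10 (θ : Stage5Params F N) (Y₀ : PrintedCarriers9X) (P : B12.RunParams) :
    (upOfRecord₅C F N (θ.pinY F N Y₀) P).b10 = (upOfRecord₅C F N θ P).b10 := rfl

/-- The two pins COMMUTE (`rfl`): pinning `Y` then `X.B10` = pinning `X.B10` then `Y`. [cite: Balaban1985UV3, Thm 1 p.257; Balaban1985BackgroundPropagators, Thm 3.1 p.397 (bookkeeping)] -/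
theorem Stage5Params.pinY_pinB10 (θ : Stage5Params F N) (Y₀ : PrintedCarriers9X) :
    (θ.pinY F N Y₀).pinB10 F N = (θ.pinB10 F N).pinY F N Y₀ := rfl

end Pin

/-! ## §3. The cumulative Stage-9 record with the [B10] AND [B9] groups pinned: `IsRecordOfRecord₉CB10Y` -/

section Record9

variable (F : T4Family) (N : ℕ) [NeZero N]

/-- The Y pin of Stage-9 parameters. [cite: Balaban1985BackgroundPropagators, Thm 3.1 p.397 (bookkeeping)] -/
def Stage9Params.pinY (θ : Stage9Params F N) (Y₀ : PrintedCarriers9X) : Stage9Params F N :=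
  { θ with res := θ.res.pinY F N Y₀ }

/-- Admissibility is unchanged (`Iff.rfl`). [cite: Balaban1987RG1, (1.20)–(1.21) p.264 (hypothesis dictionary; bookkeeping)] -/
theorem Stage9Params.pinY_admissible_iff (θ : Stage9Params F N) (Y₀ : PrintedCarriers9X) : (θ.pinY F N Y₀).Admissible ↔ θ.Admissible := Iff.rfl

/-- The Stage-3 dictionary is unchanged (`rfl`) — so the operator-layer type `OpsY` is the same before and after the pin. [cite: Balaban1984PropagatorsII, pp.223–250 (bookkeeping)] -/
theorem Stage9Params.pinY_toStage3Params (θ : Stage9Params F N) (Y₀ : PrintedCarriers9X) : (θ.pinY F N Y₀).toStage3Params = θ.toStage3Params := rfl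

/-- The Stage-5 view of Y-pinned Stage-9 parameters IS the Y-pinned Stage-5 view (`rfl`). [cite: Balaban1988Convergent, p.244 (bookkeeping)] -/
theorem Stage9Params.toStage5_pinY (θ : Stage9Params F N) (Y₀ : PrintedCarriers9X) :
    (θ.pinY F N Y₀).toStage5 F N = (θ.toStage5 F N).pinY F N Y₀ := rfl

variable {F N} in
/-- The provisos transport along the Y pin (field by field). [cite: Balaban1988Convergent, (3.2)–(3.9) pp.265–266; Balaban1989LargeFieldI, (0.3) p.176 (bookkeeping)] -/
theorem Stage9Params.Provisos.pinY {θ : Stage9Params F N} (h : θ.Provisos) (Y₀ : PrintedCarriers9X) : (θ.pinY F N Y₀).Provisos :=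
  ⟨h.intPiece, h.measω, h.measChi, h.zetaUnity, h.zetaAbs, fun p k _ hk => h.rstep p k hk⟩

variable {F N} in
/-- … and back. [cite: Balaban1988Convergent, (3.2)–(3.9) pp.265–266 (bookkeeping)] -/
theorem Stage9Params.Provisos.of_pinY {θ : Stage9Params F N} {Y₀ : PrintedCarriers9X} (h : (θ.pinY F N Y₀).Provisos) : θ.Provisos :=
  ⟨h.intPiece, h.measω, h.measChi, h.zetaUnity, h.zetaAbs, fun p k _ hk => h.rstep p k hk⟩

/-- THE PIN IS UP-SIDE at Stage 9: the datum of record is unchanged (`rfl`). [cite: Balaban1989LargeFieldII, Thm 1 + (0.1) pp.355–356 (bookkeeping)] -/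
theorem datumOfRecord₉_pinY (θ : Stage9Params F N) (h : θ.Provisos) (Y₀ : PrintedCarriers9X) :
    datumOfRecord₉ F N (θ.pinY F N Y₀) (h.pinY Y₀) = datumOfRecord₉ F N θ h := rfl

/-- **«(D, w) is the record, Stage 9, [B10] and [B9] groups pinned»** (CUMULATIVE): `IsRecordOfRecord₉CB10` VERBATIM except that the upstream block is the C-binding at
the Stage-5 view pinned by `pinB10` THEN `pinY (Y9OfRecord N θ.toStage3Params Mstar ops)` for SOME floor `Mstar` and SOME operator layer `ops` (residual data,
quantified with the record's parameters; no law on them is assumed). [cite: Balaban1985BackgroundPropagators, Thms 3.1–3.15 pp.397–432; Balaban1985UV3, Thm 1 p.257 + Thm 2 p.272; Balaban1989LargeFieldII, Thm 1 + (0.1) pp.355–356 (objects of record)] -/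
def IsRecordOfRecord₉CB10Y (D : FiniteEpsData F (SU N)) (w : WorldP) : Prop :=
  ∃ (θ : Stage9Params F N) (h : θ.Provisos) (Mstar : ℕ) (ops : OpsY N θ.toStage3Params Mstar),
    θ.Admissible ∧ D = datumOfRecord₉ F N θ h ∧ w.C = D.C ∧ (0 < w.γ ∧ w.γ ≤ θ.γ) ∧ w.L = (θ.L : ℝ) ∧
      ∀ P : B12.RunParams, w.up P = upOfRecord₅C F N (((θ.toStage5 F N).pinB10 F N).pinY F N (Y9OfRecord N θ.toStage3Params Mstar ops)) P

/-- Pointed form. [cite: Balaban1989LargeFieldII, Thm 1 + (0.1) pp.355–356 (bookkeeping)] -/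
theorem isRecordOfRecord₉CB10Y_of_eq (θ : Stage9Params F N) (h : θ.Provisos) (hθ : θ.Admissible) (Mstar : ℕ) (ops : OpsY N θ.toStage3Params Mstar)
    (w : WorldP) (hC : w.C = (datumOfRecord₉ F N θ h).C) (hγ : 0 < w.γ ∧ w.γ ≤ θ.γ) (hL : w.L = (θ.L : ℝ))
    (hup : ∀ P, w.up P = upOfRecord₅C F N (((θ.toStage5 F N).pinB10 F N).pinY F N (Y9OfRecord N θ.toStage3Params Mstar ops)) P) :
    IsRecordOfRecord₉CB10Y F N (datumOfRecord₉ F N θ h) w :=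
  ⟨θ, h, Mstar, ops, hθ, rfl, hC, hγ, hL, hup⟩

/-- **Inhabitation is Stage 9's EXACTLY**: every admissible Stage-9 parameter with its provisos, ANY floor and ANY operator layer give a record of this module at some
world, any window `0 < γw ≤ θ.γ`. [cite: Balaban1989LargeFieldII, Thm 1 + (0.1) pp.355–356 (bookkeeping)] -/
theorem exists_world_isRecordOfRecord₉CB10Y (θ : Stage9Params F N) (h : θ.Provisos) (hθ : θ.Admissible) (Mstar : ℕ)
    (ops : OpsY N θ.toStage3Params Mstar) {γw : ℝ} (hγw : 0 < γw ∧ γw ≤ θ.γ) :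
    ∃ w : WorldP, IsRecordOfRecord₉CB10Y F N (datumOfRecord₉ F N θ h) w ∧ w.γ = γw := by
  obtain ⟨w₀, -, -⟩ := exists_world_isRecordOfRecord₉C F N θ h hθ hγw
  exact ⟨{ w₀ with
      C := (datumOfRecord₉ F N θ h).C, γ := γw, L := (θ.L : ℝ), one_lt_L := by exact_mod_cast θ.hL.2,
      up := fun P => upOfRecord₅C F N (((θ.toStage5 F N).pinB10 F N).pinY F N (Y9OfRecord N θ.toStage3Params Mstar ops)) P },
    ⟨θ, h, Mstar, ops, hθ, rfl, rfl, hγw, rfl, fun _ => rfl⟩, rfl⟩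

variable {F N}
variable {D : FiniteEpsData F (SU N)} {w : WorldP}

/-- **Refinement `IsRecordOfRecord₉CB10Y → IsRecordOfRecord₉CB10`** with THE SAME datum AND world (witness `θ.pinY (Y9OfRecord …)`; the pins commute).
[cite: Balaban1985BackgroundPropagators, Thm 3.1 p.397 (bookkeeping)] -/
theorem isRecordOfRecord₉CB10_of_isRecordOfRecord₉CB10Y (h : IsRecordOfRecord₉CB10Y F N D w) : IsRecordOfRecord₉CB10 F N D w := by
  obtain ⟨θ, hP, Mstar, ops, hθ, hD, hC, hγ, hL, hup⟩ := h
  refine ⟨θ.pinY F N (Y9OfRecord N θ.toStage3Params Mstar ops), hP.pinY _, hθ, ?_, hC, hγ, hL, fun P => ?_⟩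
  · rw [datumOfRecord₉_pinY]; exact hD
  · rw [Stage9Params.toStage5_pinY, Stage5Params.pinY_pinB10]; exact hup P

/-- … hence to `IsRecordOfRecord₉C` (and to `IsRecordOfRecord₅C` at Stage 9's shadow). [cite: Balaban1989LargeFieldII, Thm 1 p.355 (bookkeeping)] -/
theorem isRecordOfRecord₉C_of_isRecordOfRecord₉CB10Y (h : IsRecordOfRecord₉CB10Y F N D w) : IsRecordOfRecord₉C F N D w :=
  isRecordOfRecord₉C_of_isRecordOfRecord₉CB10 (isRecordOfRecord₉CB10_of_isRecordOfRecord₉CB10Y h)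

/-- The `atWorld` transfer: every world-reading node theorem over `IsRecordOfRecord₅C` holds at every record of this module. [cite: Balaban1989LargeFieldII, Thm 1 p.355 (bookkeeping)] -/
theorem atWorld_of_isRecordOfRecord₉CB10Y {X : Dag.Leaves → Prop}
    (h₅ : ∀ (D : FiniteEpsData F (SU N)) (w : WorldP), IsRecordOfRecord₅C F N D w → ∀ P : B12.RunParams, X (leavesP w P))
    (h : IsRecordOfRecord₉CB10Y F N D w) (P : B12.RunParams) : X (leavesP w P) :=
  atWorld_of_isRecordOfRecord₉C h₅ (isRecordOfRecord₉C_of_isRecordOfRecord₉CB10Y h) P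

/-- Conversely, RE-BINDING a `₉CB10` record's world by the Y-pinned C-binding (any floor, any operator layer) gives a record of this module with the SAME datum.
[cite: Balaban1985BackgroundPropagators, Thm 3.1 p.397 (bookkeeping)] -/
theorem isRecordOfRecord₉CB10Y_rebind_of_isRecordOfRecord₉CB10 (h : IsRecordOfRecord₉CB10 F N D w) (Mstar : ℕ) :
    ∃ (θ : Stage9Params F N) (_ : θ.Provisos), θ.Admissible ∧ (∀ P, w.up P = upOfRecord₅C F N ((θ.toStage5 F N).pinB10 F N) P) ∧
      ∀ ops : OpsY N θ.toStage3Params Mstar,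
        IsRecordOfRecord₉CB10Y F N D
          { w with up := fun P => upOfRecord₅C F N (((θ.toStage5 F N).pinB10 F N).pinY F N (Y9OfRecord N θ.toStage3Params Mstar ops)) P } := by
  obtain ⟨θ, hP, hθ, hD, hC, hγ, hL, hup⟩ := h
  exact ⟨θ, hP, hθ, hup, fun ops => ⟨θ, hP, Mstar, ops, hθ, hD, hC, hγ, hL, fun _ => rfl⟩⟩

/-- **THE `b9` LEAF AT A RECORD OF THIS MODULE IS def-Y's LEAF AT THE BUNDLE OF RECORD**: for the record's Stage-3 dictionary, floor and operator layer,
`(leavesP w P).b9 ↔ B9LeafX (Y9OfRecord N θ₃ Mstar ops)` at every run — so def-Y's knit `B9PinCarriersKLevelV1.b9LeafX_carriersY` (geometric hypotheses discharged, the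
operator layer's obligations displayed) is the closer BY NAME. [cite: Balaban1985BackgroundPropagators, Thms 3.1–3.15 pp.397–432] -/
theorem leaf_b9_iff_of_isRecordOfRecord₉CB10Y (h : IsRecordOfRecord₉CB10Y F N D w) :
    ∃ (θ₃ : Stage3Params) (Mstar : ℕ) (ops : OpsY N θ₃ Mstar), θ₃.toStage1Params.Admissible ∧ w.L = (θ₃.L : ℝ) ∧
      ∀ P : B12.RunParams, (leavesP w P).b9 ↔ B9LeafX (Y9OfRecord N θ₃ Mstar ops) := by
  obtain ⟨θ, -, Mstar, ops, hθ, -, -, -, hL, hup⟩ := h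
  refine ⟨θ.toStage3Params, Mstar, ops, hθ.1.1.1.1, hL, fun P => ?_⟩
  show (w.up P).b9 ↔ _
  rw [hup P]
  exact upOfRecord₅C_pinY_b9_iff F N _ _ P

/-- **N06 at a record of this module, «SLOTS» FORM** (the shape of `B10RunsOfRecord.b10_main_of_isRecordOfRecord₅C_of_runsOfRecordG`): if for every parameter
package `(θ, h, Mstar, ops)` presenting `(D, w)` as a record of this module the [B9] leaf holds at the bundle of record — which is what def-Y's knit
`B9PinCarriersKLevelV1.b9LeafX_carriersY` delivers from the operator layer's displayed obligations and `N03Record.b6BlockParam_D6OfRecord` — then `Dag.B9_main` holds at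
every run (in-edges unused).  The hypothesis quantifies over the HIDDEN operator layer: honest, and exactly why N06 is not bookable in ∀-form here.
[cite: Balaban1985BackgroundPropagators, Thms 3.1–3.15 pp.397–432 (the node's shape `Dag.B9_main`, bookkeeping)] -/
theorem b9_main_of_isRecordOfRecord₉CB10Y_of_slots (h : IsRecordOfRecord₉CB10Y F N D w)
    (hops : ∀ (θ : Stage9Params F N) (hP : θ.Provisos) (Mstar : ℕ) (ops : OpsY N θ.toStage3Params Mstar), θ.Admissible →
      D = datumOfRecord₉ F N θ hP →
      (∀ P, w.up P = upOfRecord₅C F N (((θ.toStage5 F N).pinB10 F N).pinY F N (Y9OfRecord N θ.toStage3Params Mstar ops)) P) →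
        B9LeafX (Y9OfRecord N θ.toStage3Params Mstar ops))
    (P : B12.RunParams) : Dag.B9_main (leavesP w P) := by
  obtain ⟨θ, hP, Mstar, ops, hθ, hD, -, -, -, hup⟩ := h
  intro _ _ _ _
  show (w.up P).b9
  rw [hup P]
  exact (upOfRecord₅C_pinY_b9_iff F N _ _ P).2 (hops θ hP Mstar ops hθ hD hup)

/-- The [B10] pin's face SURVIVES the cumulative pin: at every record of this module `(leavesP w P).b10 ↔ PrintedUV3V N L` with `L` the world's block size.
[cite: Balaban1985UV3, Thm 1 p.257 (compact reading) + Thm 2 p.272] -/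
theorem leaf_b10_iff_of_isRecordOfRecord₉CB10Y (h : IsRecordOfRecord₉CB10Y F N D w) :
    ∃ L : ℕ, (Odd L ∧ 1 < L) ∧ w.L = (L : ℝ) ∧ ∀ P : B12.RunParams, (leavesP w P).b10 ↔ PrintedUV3V N L := by
  obtain ⟨θ, -, Mstar, ops, -, -, -, -, hL, hup⟩ := h
  refine ⟨θ.L, θ.hL, hL, fun P => ?_⟩
  show (w.up P).b10 ↔ _
  rw [hup P, upOfRecord₅C_pinY_b10]
  exact upOfRecord₅C_pinB10_b10_iff F N (θ.toStage5 F N) P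

end Record9

end Literature.MathematicalPhysics.QuantumFieldTheory.Balaban1983to89.Node00

end
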